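import Mathlib.FieldTheory.RatFunc.Basic
import Mathlib.Topology.Algebra.Group.Matrix
import Literature.NumberTheory.Automorphic.IrreducibleClasses
import Literature.NumberTheory.Automorphic.TateLocalFactors
import Literature.NumberTheory.Automorphic.WhittakerModels
import Literature.NumberTheory.Automorphic.RankinSelbergLocal
import Literature.NumberTheory.Automorphic.LocalConstants
import Literature.NumberTheory.Automorphic.ParabolicGL
import Literature.NumberTheory.Automorphic.LParameter
import Literature.NumberTheory.GaloisRepresentations.WeilDeligneRep
import Literature.NumberTheory.GaloisRepresentations.LocalClassFieldTheory
import HarnessLib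

-- provenance: harness21/H21/H21/Statements/Lang/LocalLanglandsGL.lean @ ffe28c6 (interim HEAD d8f2665); M5 mechanical rewrite
/-!
# Langlands family (`lang`): the local Langlands correspondence for `GL_n`, full form
(statement **lang.S09**; AutomorphicL outline §3, D5, D7)

Let `F` be a non-archimedean local field (`[IsNonarchimedeanLocalField F]`, Mathlib), `q` its
residue cardinality, `W_F` its Weil group.  This file states the local Langlands correspondence
for `GL_n(F)` **with the `L`- and `ε`-factors of pairs**, hence with Henniart's (1993)
uniqueness on supercuspidal representations:

* `Lang.IsLocalLanglandsGL F d 𝓔 rec` — the property, of a family of maps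
  `rec_n : Irr(GL_n(F)) → {Frobenius-semisimple n-dimensional Weil–Deligne reps}/≅`
  (`Literature.NumberTheory.Automorphic.IrrClass`, prelude I4; `Literature.NumberTheory.Automorphic.frobSemisimpleWDSetoid`, prelude G19), of being
  "the" local Langlands correspondence normalised by the local Artin datum `d`
  (`Literature.NumberTheory.GaloisRepresentations.LocalArtinData`, G09) and the system of Deligne–Langlands local constants `𝓔`
  (`Literature.NumberTheory.Automorphic.LocalEpsilonSystem`, prelude I19): bijectivity, local class field theory for
  `n = 1`, preservation of `L(s, π × π')` and `ε(s, π × π', ψ)` for generic pairs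
  `1 ≤ m < n` (JPSS predicates `HasRSLFactor`, `HasRSEpsilon` of prelude I18 against G09's
  `WeilDeligneRep.eulerFactor` and I19's `epsilonWD` of the tensor product), compatibility with
  character twists and with central characters.
* `Lang.localLanglands_gl` — **lang.S09**: such a family exists (Harris–Taylor 2001, Thm A;
  Henniart 2000), and any two such families agree on the supercuspidal classes (Henniart 1993,
  Thm 1.1: a bijection on supercuspidals compatible with class field theory, twists and the
  `ε`-factors of pairs for `m < n` is unique).  See "Uniqueness" below for why this — and not a
  bare `∃!` — is the faithful form with the present prelude.
* `Lang.IsLocalLanglandsGL.weak` — bridge to the *bijectivity clauses (a)–(c)* of the unbundled,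
  representation-level formulation of G19's weak form `Lang.localLanglands_gl_weak`
  (`H21/Statements/Lang/PAdicReps.lean`), which has no `L`/`ε` of pairs and no uniqueness and
  stays as it is.
* helpers: `Lang.charDet n χ = χ ∘ det`, `Lang.isOpen_ker_charDet` (proved),
  `Lang.isOpen_ker_quasiChar` (no small subgroups; named fact).

D-0014 (Literature carries no unproved proof terms): `localLanglands_gl` (**lang.S09**),
`isOpen_ker_quasiChar` and `IsLocalLanglandsGL.weak` are named facts
`def <name> : Prop := <statement>`; the `LocalGaloisGroup`/`LocalConstants` named facts consumed
by `WeilDeligneRep.eulerFactor`, `epsilonWD`, `WeilDeligneRep.ofQuasiChar` are threaded as the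
explicit hypotheses `hmul huniq` (`IsFrobPow.mul/unique`), `hn : absInertia_normal F`,
`hex : exists_isFrobPow`, `hns : WeilGroup.exists_subgroup_le_inertia_isOpen_of_continuous` of
`IsLocalLanglandsGL` (signature `IsLocalLanglandsGL F hmul huniq hn hex hns d 𝓔 rec`).

## Mathlib search

Mathlib (this pin) has `IsNonarchimedeanLocalField`, `Matrix.GeneralLinearGroup` with `det`,
`scalar`, `continuous_det`, `Representation`, `Representation.Equiv`, `Representation.tprod`,
`ContinuousMonoidHom`, `RatFunc`, `AddChar`, `MeasureTheory.SMulInvariantMeasure`,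
`Measure.IsAddHaarMeasure`, `Quotient.out`, all used; it has no Weil–Deligne representations, no
smooth representation theory of `p`-adic groups, no Rankin–Selberg factors and no local Langlands
correspondence (`rg -i langlands`, `rg -i 'Weil.?Deligne'`, `rg -i rankin` in Mathlib: nothing
relevant).  Nothing here duplicates a Mathlib declaration.

## Design choices

* `F : Type` (universe `0`): forced by `LocalEpsilonSystem F` (outline H9); representation
  spaces of `SmoothIrrep` are in `Type` as well.
* `rec` is valued in isomorphism classes; wherever a representative is needed (Euler factor and
  `ε`-factor of `rec π ⊗ rec π'`, `det ∘ rec π`) we use `Quotient.out` — every quantity read off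
  is an isomorphism invariant, and comparisons of Weil–Deligne representations on different
  spaces are through `WeilDeligneRep.IsEquivalent`.
* `L`- and `ε`-factors of pairs are imposed for `1 ≤ m < n` only (JPSS 1983; this is exactly the
  range used in Henniart's 1993 characterisation), for *generic* `π`, `π'` (`IsGeneric`; RS
  factors are unique only there, outline §4) and continuous non-trivial `ψ`; every irreducible
  smooth representation of `GL_n(F)` is admissible (Jacquet), so admissibility is not repeated.
  The measure hypotheses copy those of `existsUnique_hasRSLFactor` / `existsUnique_hasRSEpsilon`;
  the additive Haar measure `μ` is required self-dual for `ψ` (`IsSelfDualMeasure`) on both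
  sides, which is the normalisation under which `ε(s, π × π', ψ) = ε(s, rec π ⊗ rec π', ψ)`.
* The `ε`-clause reads: the RS monomial data `(e, a)` (`ε = e q^{-a s}`) are exactly those for
  which the Galois `ε`-factor `epsilonWD 𝓔 ψ μ (rec π ⊗ rec π') s` equals `e (q^{-s})^a` for all
  `s` (`epsilonWD` is an entire monomial in `q^{-s}`, no poles to avoid).
* Twists: `IrrClass.twist` needs an open-kernel hypothesis; the field `twist` quantifies over
  quasi-characters `χ : QuasiChar F` together with `hχ : IsOpen (ker χ)`, which every
  quasi-character satisfies (`isOpen_ker_quasiChar`, `ℂˣ` has no small subgroups), so no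
  generality is lost and no unproved fact enters a definition.
* `localLanglands_gl` carries the hypothesis `𝓔.artin F = d`: the local constants must be
  normalised (`LocalEpsilonSystem.dim_one`) against the same Artin map that normalises `rec₁`,
  otherwise the `GL₁ × GL₁ ⊂ GL₂ × GL₁` constraints are inconsistent.  Both data exist
  (`nonempty_localArtinData`, `nonempty_localEpsilonSystem` — the latter non-vacuous now that
  Tate's `ε` is monomial data, outline review response 1).  `𝓔` is unique given its Artin data
  (`localEpsilonSystem_unique`, prelude I19), but `d : LocalArtinData F` is an *arbitrary* datum:
  G09 (`LocalClassFieldTheory.lean`) deliberately states existence only, and the structure admits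
  non-canonical data (compose the Artin map with an automorphism of `𝒪_Fˣ`).  Asserting the
  theorem for every `d` (with `𝓔.artin F = d`) rather than for the canonical Artin map is thus
  an over-statement inherited from G09/I19 and prescribed by the outline (§3, §4.4 — signature
  `(F) (d) (𝓔)`); the quantifier is over `rec` only.

## Uniqueness (why not `∃!`)

The fields `lFactor_pairs`/`epsilon_pairs` can only constrain *generic* pairs: the JPSS
predicates `HasRSLFactor`/`HasRSEpsilon` are phrased through Whittaker functionals, and for
non-generic `π` one has `whittakerFunctionals π ψ = ⊥`, so without `IsGeneric` the fields
would be contradictory.  Consequently the non-generic classes are pinned only by `bijective`,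
`twist`, `centralChar`, and these do not determine `rec` there (e.g. on `GL₂`, re-labelling
`χ ∘ det ↦ rec₂ ((χη) ∘ det)` for a fixed quadratic `η` respects all three).  A literal `∃!`
would therefore be false.  Uniqueness in print (Harris–Taylor Thm A, via Henniart 1993) uses
`L`/`ε` of pairs for *all* pairs, defined for non-generic representations through the Langlands
classification (Langlands quotients), which `Prelude/AutomorphicL` does not have.  We state
exactly what Henniart 1993, Thm 1.1 gives and the prelude can express: any two families with
`IsLocalLanglandsGL` agree on supercuspidal classes (`IrrClass.IsSupercuspidal`, prelude I4).
Full uniqueness awaits a Langlands-classification clause in the prelude.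

## References

* M. Harris, R. Taylor, *The geometry and cohomology of some simple Shimura varieties*, Annals
  of Math. Studies 151 (2001), Theorem A (and VII.2.20).
* G. Henniart, *Une preuve simple des conjectures de Langlands pour `GL(n)` sur un corps
  `p`-adique*, Invent. Math. 139 (2000), Thm. 1.2.
* G. Henniart, *Caractérisation de la correspondance de Langlands locale par les facteurs `ε` de
  paires*, Invent. Math. 113 (1993), Thm. 1.1.
* P. Scholze, *The local Langlands correspondence for `GL_n` over `p`-adic fields*, Invent.
  Math. 192 (2013), Thm. 1.2.
* H. Jacquet, I. Piatetski-Shapiro, J. Shalika, *Rankin–Selberg convolutions*, Amer. J. Math.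
  105 (1983), Thm. 2.7.
* P. Deligne, *Les constantes des équations fonctionnelles des fonctions `L`*, LNM 349 (1973).
-/

noncomputable section

open scoped MatrixGroups Polynomial
open Matrix MeasureTheory ValuativeRel

namespace Literature.NumberTheory.Automorphic

open GaloisRepresentations.IsNonarchimedeanLocalField

/-! ### Helpers: the character `χ ∘ det` -/

section CharDet

variable {F : Type*} [Field F] [TopologicalSpace F]

/-- The character `χ ∘ det : GL_n(F) →* ℂˣ` attached to a quasi-character `χ : Fˣ →ₜ* ℂˣ`
(`Literature.NumberTheory.Automorphic.QuasiChar`); twisting by it is `π ↦ π ⊗ (χ ∘ det)`.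
Ref: Bushnell–Henniart, *The local Langlands conjecture for `GL(2)`* (2006), §9.1;
Harris–Taylor (2001), Thm A (iv). [cite: HarrisTaylor2001] -/
def charDet (n : ℕ) (χ : QuasiChar F) : GL (Fin n) F →* ℂˣ :=
  (χ : Fˣ →* ℂˣ).comp Matrix.GeneralLinearGroup.det

/-- Unfolding lemma for `charDet`. [folklore] -/
@[simp] theorem charDet_apply (n : ℕ) (χ : QuasiChar F) (g : GL (Fin n) F) :
    charDet n χ g = χ (Matrix.GeneralLinearGroup.det g) := rfl

/-- If `χ` has open kernel then so has `χ ∘ det` (`det : GL_n(F) → Fˣ` is continuous, Mathlib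
`Matrix.GeneralLinearGroup.continuous_det`).
Ref: Bushnell–Henniart (2006), §9.1. [cite: BushnellHenniart2006] -/
theorem isOpen_ker_charDet [IsTopologicalRing F] (n : ℕ) {χ : QuasiChar F}
    (hχ : IsOpen ((χ : Fˣ →* ℂˣ).ker : Set Fˣ)) :
    IsOpen ((charDet n χ).ker : Set (GL (Fin n) F)) := by
  have h : ((charDet n χ).ker : Set (GL (Fin n) F)) =
      Matrix.GeneralLinearGroup.det ⁻¹' ((χ : Fˣ →* ℂˣ).ker : Set Fˣ) := by
    ext g
    simp [MonoidHom.mem_ker, charDet]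
  rw [h]
  exact hχ.preimage Matrix.GeneralLinearGroup.continuous_det

/-- **Quasi-characters are smooth**: a continuous `χ : Fˣ →ₜ* ℂˣ` has open kernel (`Fˣ` has a
neighbourhood basis of `1` of open subgroups `1 + 𝔭ⁿ`, and `ℂˣ` has no small subgroups).  Hence
the hypothesis `hχ` of `IsLocalLanglandsGL.twist` is satisfied by every quasi-character.
Ref: Bushnell–Henniart (2006), §1.1, §1.5; Tate, *Number theoretic background* (Corvallis
1979), (2.2).  Named fact (D-0014). [cite: BushnellHenniart2006] -/
def isOpen_ker_quasiChar [ValuativeRel F] [IsNonarchimedeanLocalField F] : Prop :=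
  ∀ (χ : QuasiChar F), IsOpen ((χ : Fˣ →* ℂˣ).ker : Set Fˣ)

end CharDet

/-! ### lang.S09: the property of being the local Langlands correspondence -/

section S09

variable (F : Type) [Field F] [ValuativeRel F] [TopologicalSpace F] [IsNonarchimedeanLocalField F]

variable (hmul : GaloisRepresentations.IsFrobPow.mul (F := F)) (huniq : GaloisRepresentations.IsFrobPow.unique (F := F))
  (hn : GaloisRepresentations.absInertia_normal F) (hex : GaloisRepresentations.exists_isFrobPow (F := F))
  (hns : GaloisRepresentations.WeilGroup.exists_subgroup_le_inertia_isOpen_of_continuous (F := F))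

/-- **lang.S09** (the defining properties; Harris–Taylor 2001, Thm A (i)–(v); Henniart 2000,
Thm 1.2; Henniart 1993, Thm 1.1; JPSS 1983, Thm 2.7; Deligne 1973, §8.12).
`IsLocalLanglandsGL F d 𝓔 rec` says that the family
`rec = (rec_n)_n`, `rec_n : Irr(GL_n(F)) → {Frobenius-semisimple n-dim Weil–Deligne reps}/≅`
(`IrrClass (GL (Fin n) F) → Quotient (frobSemisimpleWDSetoid F n)`) **is a local Langlands
correspondence** for the general linear groups over `F`, normalised by the local Artin datum `d`
(geometric Frobenius ↦ uniformiser) and the system of local constants `𝓔`: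

* `bijective`: every `rec_n` is a bijection;
* `gl_one`: for `n = 1`, if `GL₁(F)` acts on `π` through `χ ∘ det` for a quasi-character `χ`,
  then `rec₁ π ≅ (χ ∘ artin, N = 0)` (`WeilDeligneRep.ofQuasiChar d χ`, i.e. `d.recGL1 χ`);
* `lFactor_pairs`: for `1 ≤ m < n`, generic `π ∈ Irr(GL_n)`, `π' ∈ Irr(GL_m)`, continuous
  non-trivial `ψ` and an invariant measure on `GL_m(F) ⧸ U_m`, the JPSS `L`-polynomial of the
  pair is the Euler factor of `rec_n π ⊗ rec_m π'`:
  `L(s, π × π') = L(s, rec π ⊗ rec π')` (`HasRSLFactor … P ↔ P = eulerFactor (tprod …)`);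
* `epsilon_pairs`: under the same hypotheses and with the self-dual Haar measure `μ` for `ψ`,
  `ε(s, π × π', ψ) = ε(s, rec π ⊗ rec π', ψ)`: the RS monomial data `(e, a)`
  (`ε = e · q^{-a s}`, `HasRSEpsilon`) are exactly those with
  `epsilonWD 𝓔 ψ μ (rec π ⊗ rec π') s = e · (q^{-s})^a` for all `s`;
* `twist`: `rec_n (π ⊗ (χ ∘ det)) ≅ rec_n π ⊗ (χ ∘ artin)` (`IrrClass.twist`, `charDet`,
  `WeilDeligneRep.tprod`, `ofQuasiChar`), for quasi-characters `χ` with open kernel (all of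
  them, `isOpen_ker_quasiChar`);
* `centralChar`: `det ∘ rec_n π = ω_π ∘ artin`: if the central element `artin w · 1` acts on
  `π` by the scalar `c` then `det (rec_n π)(w) = c`.

Representatives of classes are taken with `Quotient.out`; all quantities read are isomorphism
invariants.  The `LocalGaloisGroup`/`LocalConstants` named facts consumed by `eulerFactor`,
`epsilonWD` and `ofQuasiChar` are the explicit hypotheses `hmul huniq hn hex hns` (D-0014).
[cite: HarrisTaylor2001, Thm A (i] -/
structure IsLocalLanglandsGL (d : GaloisRepresentations.LocalArtinData F) (𝓔 : LocalEpsilonSystem F)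
    (rec : ∀ n : ℕ, IrrClass (GL (Fin n) F) → Quotient (frobSemisimpleWDSetoid F n)) :
    Prop where
  /-- (i) Each `rec_n` is a bijection `Irr(GL_n(F)) ≃ {Frob-ss n-dim WD reps}/≅`
  (Harris–Taylor 2001, Thm A). -/
  bijective : ∀ n : ℕ, Function.Bijective (rec n)
  /-- (ii) `n = 1`: `rec₁` is local class field theory, `χ ∘ det ↦ χ ∘ artin`
  (Harris–Taylor 2001, Thm A (i); Tate, Corvallis 1979, (1.4.5)). -/
  gl_one : ∀ (χ : QuasiChar F) (π : SmoothIrrep (GL (Fin 1) F)),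
    (∀ (g : GL (Fin 1) F) (v : π.V),
      π.ρ g v = ((χ (Matrix.GeneralLinearGroup.det g) : ℂˣ) : ℂ) • v) →
    ((rec 1 (IrrClass.mk π)).out.1).IsEquivalent (GaloisRepresentations.WeilDeligneRep.ofQuasiChar hns d χ)
  /-- (iii-L) Preservation of `L`-factors of pairs, `1 ≤ m < n`, generic `π`, `π'`
  (Harris–Taylor 2001, Thm A (v); Henniart 1993; JPSS 1983, Thm 2.7 (i)–(ii)). -/
  lFactor_pairs : ∀ ⦃m n : ℕ⦄ (_hm : 0 < m) (hmn : m < n) (π : SmoothIrrep (GL (Fin n) F))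
    (π' : SmoothIrrep (GL (Fin m) F)) (ψ : AddChar F Circle), ψ.IsContinuousNontrivial →
    IsGeneric π.ρ ψ → IsGeneric π'.ρ ψ⁻¹ →
    ∀ [MeasurableSpace (GL (Fin m) F ⧸ upperUnitriangular (Fin m) F)]
      [BorelSpace (GL (Fin m) F ⧸ upperUnitriangular (Fin m) F)]
      (ν : Measure (GL (Fin m) F ⧸ upperUnitriangular (Fin m) F))
      [SMulInvariantMeasure (GL (Fin m) F) (GL (Fin m) F ⧸ upperUnitriangular (Fin m) F) ν]
      [IsFiniteMeasureOnCompacts ν] [ν.IsOpenPosMeasure] (P : ℂ[X]),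
      HasRSLFactor hmn π.ρ π'.ρ ψ ν P ↔
        P = (((rec n (IrrClass.mk π)).out.1).tprod
              ((rec m (IrrClass.mk π')).out.1)).eulerFactor hn hex
  /-- (iii-ε) Preservation of `ε`-factors of pairs, `1 ≤ m < n`, generic `π`, `π'`, self-dual
  `μ` (Harris–Taylor 2001, Thm A (v); Henniart 1993, Thm 1.1; JPSS 1983, Thm 2.7 (iii);
  Deligne 1973, §8.12). -/
  epsilon_pairs : ∀ ⦃m n : ℕ⦄ (_hm : 0 < m) (hmn : m < n) (π : SmoothIrrep (GL (Fin n) F))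
    (π' : SmoothIrrep (GL (Fin m) F)) (ψ : AddChar F Circle), ψ.IsContinuousNontrivial →
    IsGeneric π.ρ ψ → IsGeneric π'.ρ ψ⁻¹ →
    ∀ [MeasurableSpace F] [BorelSpace F] (μ : Measure F) [μ.IsAddHaarMeasure],
      IsSelfDualMeasure ψ μ →
    ∀ [MeasurableSpace (GL (Fin m) F ⧸ upperUnitriangular (Fin m) F)]
      [BorelSpace (GL (Fin m) F ⧸ upperUnitriangular (Fin m) F)]
      (ν : Measure (GL (Fin m) F ⧸ upperUnitriangular (Fin m) F))
      [SMulInvariantMeasure (GL (Fin m) F) (GL (Fin m) F ⧸ upperUnitriangular (Fin m) F) ν]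
      [IsFiniteMeasureOnCompacts ν] [ν.IsOpenPosMeasure] (e : ℂ) (a : ℤ),
      HasRSEpsilon hmn π.ρ π'.ρ ψ μ ν e a ↔
        ∀ s : ℂ, epsilonWD hmul huniq hn hex 𝓔 ψ μ
            (((rec n (IrrClass.mk π)).out.1).tprod ((rec m (IrrClass.mk π')).out.1)) s =
          e * (((residueFieldCard F : ℂ) ^ (-s)) ^ a)
  /-- (iv) Compatibility with character twists: `rec (π ⊗ χ∘det) ≅ rec π ⊗ χ∘artin`
  (Harris–Taylor 2001, Thm A (iv); Henniart 2000, Thm 1.2 (3)). -/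
  twist : ∀ (n : ℕ) (χ : QuasiChar F) (hχ : IsOpen ((χ : Fˣ →* ℂˣ).ker : Set Fˣ))
    (π : SmoothIrrep (GL (Fin n) F)),
    ((rec n (IrrClass.twist (charDet n χ) (isOpen_ker_charDet n hχ) (IrrClass.mk π))).out.1)
      |>.IsEquivalent
        (((rec n (IrrClass.mk π)).out.1).tprod (GaloisRepresentations.WeilDeligneRep.ofQuasiChar hns d χ))
  /-- (v) Central characters: `det ∘ rec_n π = ω_π ∘ artin`
  (Harris–Taylor 2001, Thm A (ii); Henniart 2000, Thm 1.2 (4)). -/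
  centralChar : ∀ (n : ℕ) (π : SmoothIrrep (GL (Fin n) F)) (w : GaloisRepresentations.WeilGroup F) (c : ℂ),
    π.ρ (Matrix.GeneralLinearGroup.scalar (Fin n) (d.artin w)) = c • LinearMap.id →
    LinearMap.det (((rec n (IrrClass.mk π)).out.1).ρ w) = c

/-- **lang.S09**
full form with `L`- and `ε`-factors of pairs (Harris–Taylor, *The geometry and cohomology of
some simple Shimura varieties* (2001), Thm A; Henniart, Invent. Math. 139 (2000), Thm 1.2;
uniqueness: Henniart, Invent. Math. 113 (1993), Thm 1.1; also Scholze, Invent. Math. 192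
(2013), Thm 1.2).

**The local Langlands correspondence for `GL_n` over a non-archimedean local field `F`.**
Fix a local Artin datum `d` (G09 `LocalArtinData`) and a system of Deligne–Langlands local
constants `𝓔` normalised against `d` (`𝓔.artin F = d`; prelude I19 `LocalEpsilonSystem`).
Then there is a family of bijections
`rec_n : Irr(GL_n(F)) → {Frobenius-semisimple n-dimensional Weil–Deligne representations}/≅`
compatible with local class field theory for `n = 1`, with twists and central characters, and
preserving the `L`- and `ε`-factors of pairs (`IsLocalLanglandsGL`); and any two such families
agree on every **supercuspidal** class (`IrrClass.IsSupercuspidal`) — Henniart's 1993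
characterisation (Thm 1.1) of the correspondence on supercuspidals by class field theory,
twists and `ε`-factors of pairs `GL_n × GL_m`, `m < n`.

Notes. (1) G19's `Lang.localLanglands_gl_weak` (`H21/Statements/Lang/PAdicReps.lean`) is the
weak form (no `L`/`ε` of pairs, no uniqueness) and stays; `IsLocalLanglandsGL.weak` bridges to
its bijectivity clauses (a)–(c).  (2) On the parameters: `𝓔` is unique given its Artin data
(`localEpsilonSystem_unique`, prelude I19) and exists (`nonempty_localEpsilonSystem`); `d` is an
arbitrary local Artin datum (G09 states existence `nonempty_localArtinData` but deliberately no
uniqueness), so asserting the theorem for every `d` with `𝓔.artin F = d` is an over-statement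
w.r.t. the literature (canonical Artin map) inherited from G09/I19 and prescribed by the
outline; the quantifier is over `rec` only.  (3) Full uniqueness of `rec` (Harris–Taylor Thm A)
is NOT asserted: it needs `L`/`ε` of pairs for non-generic representations via the Langlands
classification, which the prelude lacks; with the present fields a bare `∃!` would be false
(non-generic classes are not pinned; see the module docstring, "Uniqueness").
(4) Non-vacuity: `LocalEpsilonSystem F` is inhabited (`nonempty_localEpsilonSystem`) now that
Tate's `ε` is monomial data (outline review response 1), and for its witness `𝓔` one may take
`d := 𝓔.artin F`.  (5) Named fact (D-0014); the `LocalGaloisGroup`/`LocalConstants` named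
facts are the explicit hypotheses `hmul huniq hn hex hns` of `IsLocalLanglandsGL`.
[cite: Henniarts1993, characterisation (Thm 1.1] -/
def localLanglands_gl (d : GaloisRepresentations.LocalArtinData F) (𝓔 : LocalEpsilonSystem F)
    (_hd : 𝓔.artin F = d) : Prop :=
    ∃ rec : ∀ n : ℕ, IrrClass (GL (Fin n) F) → Quotient (frobSemisimpleWDSetoid F n),
      IsLocalLanglandsGL F hmul huniq hn hex hns d 𝓔 rec ∧
      ∀ rec' : ∀ n : ℕ, IrrClass (GL (Fin n) F) → Quotient (frobSemisimpleWDSetoid F n),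
        IsLocalLanglandsGL F hmul huniq hn hex hns d 𝓔 rec' →
        ∀ (n : ℕ) (c : IrrClass (GL (Fin n) F)), c.IsSupercuspidal → rec' n c = rec n c

/-- **lang.S09** (uniqueness on supercuspidals, symmetric form; Henniart, Invent. Math. 113
(1993), Thm 1.1).  Any two local Langlands correspondences `rec`, `rec'` for `GL_n` over `F`
(same normalising data `d`, `𝓔`) agree on every supercuspidal class.  Hypothesis `hS09`: the
named fact `localLanglands_gl` (D-0014). [folklore] -/
theorem IsLocalLanglandsGL.unique_of_isSupercuspidal {d : GaloisRepresentations.LocalArtinData F}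
    {𝓔 : LocalEpsilonSystem F} (hd : 𝓔.artin F = d)
    (hS09 : localLanglands_gl F hmul huniq hn hex hns d 𝓔 hd)
    {rec rec' : ∀ n : ℕ, IrrClass (GL (Fin n) F) → Quotient (frobSemisimpleWDSetoid F n)}
    (h : IsLocalLanglandsGL F hmul huniq hn hex hns d 𝓔 rec)
    (h' : IsLocalLanglandsGL F hmul huniq hn hex hns d 𝓔 rec') {n : ℕ}
    (c : IrrClass (GL (Fin n) F)) (hc : c.IsSupercuspidal) : rec n c = rec' n c := by
  obtain ⟨r, -, hr⟩ := hS09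
  rw [hr rec h n c hc, hr rec' h' n c hc]

variable {F}

/-- **Bridge to the bijectivity clauses (a)–(c) of the weak form** (Harris–Taylor 2001, Thm A;
cf. G19 `Lang.localLanglands_gl_weak`, `H21/Statements/Lang/PAdicReps.lean`).  Only clauses
(a) Frobenius-semisimplicity, (b) isomorphism invariance, (c) bijectivity on smooth
irreducibles of that theorem are reproduced here — NOT its clauses (d)–(g) (class field theory,
twists, central characters, unramified/Satake), which live at class level in the fields
`gl_one`, `twist`, `centralChar` above.  A local Langlands correspondence `rec` on isomorphism
classes yields a representation-level family `rec'_n ρ ∈ WDRep_n` (values on non-(smooth irreducible)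
`ρ` being junk, here the trivial representation) which is Frobenius-semisimple-valued,
isomorphism invariant, bijective from smooth irreducibles onto Frobenius-semisimple classes,
and represents `rec_n [π]` on every irreducible smooth `π`.  (Take
`rec'_n ρ := (rec_n [ρ]).out` if `ρ` is smooth irreducible, `trivial` otherwise.)  Named fact
(D-0014). [cite: HarrisTaylor2001, Thm A] -/
def IsLocalLanglandsGL.weak : Prop :=
  ∀ {d : GaloisRepresentations.LocalArtinData F} {𝓔 : LocalEpsilonSystem F}
    {rec : ∀ n : ℕ, IrrClass (GL (Fin n) F) → Quotient (frobSemisimpleWDSetoid F n)}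
    (_h : IsLocalLanglandsGL F hmul huniq hn hex hns d 𝓔 rec),
    ∃ rec' : (n : ℕ) → (V : Type) → [AddCommGroup V] → [Module ℂ V] →
        Representation ℂ (GL (Fin n) F) V → GaloisRepresentations.WeilDeligneRep F ℂ (Fin n → ℂ),
      ∀ n : ℕ,
      (∀ (V : Type) [AddCommGroup V] [Module ℂ V] (ρ : Representation ℂ (GL (Fin n) F) V),
          (rec' n V ρ).IsFrobSemisimple) ∧
      (∀ (V : Type) [AddCommGroup V] [Module ℂ V] (V' : Type) [AddCommGroup V'] [Module ℂ V']
          (ρ : Representation ℂ (GL (Fin n) F) V) (ρ' : Representation ℂ (GL (Fin n) F) V'),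
          Nonempty (ρ.Equiv ρ') → (rec' n V ρ).IsEquivalent (rec' n V' ρ')) ∧
      (∀ r : GaloisRepresentations.WeilDeligneRep F ℂ (Fin n → ℂ), r.IsFrobSemisimple →
          ∃ π : SmoothIrrep (GL (Fin n) F), (rec' n π.V π.ρ).IsEquivalent r) ∧
      (∀ π π' : SmoothIrrep (GL (Fin n) F),
          (rec' n π.V π.ρ).IsEquivalent (rec' n π'.V π'.ρ) → Nonempty (π.ρ.Equiv π'.ρ)) ∧
      (∀ π : SmoothIrrep (GL (Fin n) F), rec' n π.V π.ρ = (rec n (IrrClass.mk π)).out.1)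

end S09

end Literature.NumberTheory.Automorphic
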